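import Summits.CriticalPhenomena.PercolationContinuityZ3.Theorems.PercNearOneGluingNoHeavyLowerTailSahiCTCWeightedLYM
import Summits.CriticalPhenomena.PercolationContinuityZ3.Theorems.PercNearOneGluingNoHeavyLowerTailSahiCTCForms
import Summits.CriticalPhenomena.PercolationContinuityZ3.Theorems.PercNearOneGluingNoHeavyLowerTailSahiCTCKleitmanSurplus
import Summits.CriticalPhenomena.PercolationContinuityZ3.Theorems.PercNearOneGluingNoHeavyLowerTailSahiCTCSignature
import HarnessLib

/-!
# `NoHeavyLowerTail` (crux stmt-CriticalPhenomena-4575), P3 lane: the coefficients of the Harris form are Kleitman surpluses of traces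
# (memo g25 §1)

Support file (seat `prim-l12-p3`, gen 25; `--supports stmt-CriticalPhenomena-4575`).  For any families `𝒳, 𝒵 ⊆ 2^α` and a profile `n ≤ 2`
with doubled set `D = dbl n` and single set `s = supp n \ D`:
* `coeff_gf_mul_gf_eq_card_tr` : `coeff n (GF(𝒳)·GF(𝒵)) = #{U ∈ tr 𝒳 D s : s \ U ∈ tr 𝒵 D s}` (a bijection refining `…HarrisBlock.coeff_harris`);
* `coeff_PiP_mul_gf_eq_card_tr` : `coeff n (Π·GF(𝒴)) = #(tr 𝒴 D s)`;
* `coeff_harrisForm_eq_kap` : `coeff n (Π·GF(𝒳∩𝒵) − GF(𝒳)·GF(𝒵)) = kap 𝒳 𝒵 D s`, and `= 0` if some `n i ≥ 3` (`coeff_harrisForm_eq_zero`);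
* `coeff_ee_two_mul` : `coeff m (e₂·P) = Σ_{E : #E = 2, 1_E ≤ m} coeff (m − 1_E) P`.
Nothing is asserted about the crux.
Second part (bookkeeping for the ladder form `L₂` coefficient by coefficient, memo g25 §1): level sets `lev m k` (with `SahiAllButC.ind_le_iff_subset_support` / `tsub_ind_apply` of `…SahiCTCSignature`); the residual profile `m − 1_E` of a
2-set `E` has doubled set `(M ∩ E) ∪ (D \ E)` and single set `(D ∩ E) ∪ (T \ E)` (`dbl_sub_ind`, `sgl_sub_ind`; `M, D, T` = level sets 3, 2, 1);
the two sides of `L₂` expand as `coeff m (e₂·H) ≥ Σ_{E ∈ S} coeff (m − 1_E) H` for any admissible `S` (`sum_le_coeff_ee_two_mul_harris`) and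
`coeff m (Θ₁·e_{≥2}·GF(W)) = Σ_{e ∈ W} γ(m − 1_e)` (`coeff_charge_eq_sum`) with the bounds `coeff_Th1_mul_atLeastTwo_le_*` on `γ`.
-/

namespace Summit.CriticalPhenomena.PercolationContinuityZ3.Theorems.SahiCTCForms

open Finset MvPolynomial SahiCTCGenFun SahiCTCWeightedLYM

variable {α : Type*} [DecidableEq α] [Fintype α]

/-- The single set of a profile: support minus doubled points. [this work] -/
def sgl (n : α →₀ ℕ) : Finset α := n.support \ dbl n

omit [DecidableEq α] [Fintype α] in
/-- The doubled points lie in the support. [this work] -/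
theorem dbl_subset_support (n : α →₀ ℕ) : dbl n ⊆ n.support := filter_subset _ _

omit [Fintype α] in
/-- Doubled and single points are disjoint. [this work] -/
theorem disjoint_dbl_sgl (n : α →₀ ℕ) : Disjoint (dbl n) (sgl n) := disjoint_sdiff

omit [Fintype α] in
/-- Doubled and single points cover the support. [this work] -/
theorem dbl_union_sgl (n : α →₀ ℕ) : dbl n ∪ sgl n = n.support := union_sdiff_of_subset (dbl_subset_support n)

omit [Fintype α] in
/-- **`coeff n (GF(𝒳)·GF(𝒵)) = #{U ∈ tr 𝒳 D s : s \ U ∈ tr 𝒵 D s}`** for `n ≤ 2` (`D = dbl n`, `s = sgl n`): the pairs `(P, S)` with `1_P + 1_S = n`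
are `(D ∪ U, D ∪ (s \ U))`. [this work] -/
theorem coeff_gf_mul_gf_eq_card_tr (𝒳 𝒵 : Finset (Finset α)) {n : α →₀ ℕ} (hn : ∀ i, n i ≤ 2) :
    (gf 𝒳 * gf 𝒵).coeff n = #((tr 𝒳 (dbl n) (sgl n)).filter fun U => sgl n \ U ∈ tr 𝒵 (dbl n) (sgl n)) := by
  rw [coeff_gf_mul_gf]
  set D := dbl n
  set N := n.support
  have hDN : D ⊆ N := dbl_subset_support n
  have hs : sgl n = N \ D := rfl
  have hpair : ∀ {P S : Finset α}, ind P + ind S = n ↔ P ∩ S = D ∧ P ∪ S = N := fun {P S} => by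
    rw [ind_add_ind_eq_iff]; exact ⟨fun h => h.2, fun h => ⟨hn, h⟩⟩
  congr 1
  refine card_bij (fun PS _ => PS.1 \ D) (fun PS hPS => ?_) (fun PS hPS QT hQT h => ?_) (fun U hU => ?_)
  · obtain ⟨hmem, hsum⟩ := mem_filter.1 hPS
    obtain ⟨hP, hS⟩ := mem_product.1 hmem
    obtain ⟨hI, hU⟩ := hpair.1 hsum
    have hDP : D ⊆ PS.1 := hI ▸ inter_subset_left
    have hPN : PS.1 ⊆ N := hU ▸ subset_union_left
    have hS' : PS.2 = D ∪ (N \ PS.1) :=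
      fst_eq_of_inter_union (by rw [inter_comm]; exact hI) (by rw [union_comm]; exact hU)
    have e1 : sgl n \ (PS.1 \ D) = N \ PS.1 := by
      ext x; simp only [hs, mem_sdiff]; constructor
      · rintro ⟨⟨hxN, hxD⟩, h⟩; exact ⟨hxN, fun hxP => h ⟨hxP, hxD⟩⟩
      · rintro ⟨hxN, hxP⟩; exact ⟨⟨hxN, fun hxD => hxP (hDP hxD)⟩, fun h => hxP h.1⟩
    refine mem_filter.2 ⟨mem_tr.2 ⟨by rw [hs]; exact sdiff_subset_sdiff hPN Subset.rfl, ?_⟩, mem_tr.2 ⟨sdiff_subset, ?_⟩⟩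
    · rw [union_sdiff_of_subset hDP]; exact hP
    · rw [e1, ← hS']; exact hS
  · obtain ⟨_, hsum⟩ := mem_filter.1 hPS
    obtain ⟨_, hsum'⟩ := mem_filter.1 hQT
    obtain ⟨hI, hU⟩ := hpair.1 hsum
    obtain ⟨hI', hU'⟩ := hpair.1 hsum'
    have hDP : D ⊆ PS.1 := hI ▸ inter_subset_left
    have hDQ : D ⊆ QT.1 := hI' ▸ inter_subset_left
    have h' : PS.1 \ D = QT.1 \ D := h
    have h1 : PS.1 = QT.1 := by rw [← union_sdiff_of_subset hDP, ← union_sdiff_of_subset hDQ, h']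
    have e1 : PS.2 = D ∪ (N \ PS.1) := fst_eq_of_inter_union (by rw [inter_comm]; exact hI) (by rw [union_comm]; exact hU)
    have e2 : QT.2 = D ∪ (N \ QT.1) := fst_eq_of_inter_union (by rw [inter_comm]; exact hI') (by rw [union_comm]; exact hU')
    exact Prod.ext h1 (by rw [e1, e2, h1])
  · obtain ⟨hUX, hUZ⟩ := mem_filter.1 hU
    obtain ⟨hUs, hUX'⟩ := mem_tr.1 hUX
    obtain ⟨_, hUZ'⟩ := mem_tr.1 hUZ
    have hUD : Disjoint D U := Disjoint.mono_right hUs (disjoint_dbl_sgl n)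
    refine ⟨(D ∪ U, D ∪ (sgl n \ U)), mem_filter.2 ⟨mem_product.2 ⟨hUX', hUZ'⟩, hpair.2 ⟨?_, ?_⟩⟩, union_sdiff_cancel_left hUD⟩
    · rw [← union_inter_distrib_left, inter_sdiff_self, union_empty]
    · rw [union_union_union_comm, union_idempotent, union_sdiff_of_subset hUs]; exact dbl_union_sgl n

/-- **`coeff n (Π·GF(𝒴)) = #(tr 𝒴 D s)`** for `n ≤ 2`. [this work] -/
theorem coeff_PiP_mul_gf_eq_card_tr (𝒴 : Finset (Finset α)) {n : α →₀ ℕ} (hn : ∀ i, n i ≤ 2) :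
    ((PiP : MvPolynomial α ℤ) * gf 𝒴).coeff n = #(tr 𝒴 (dbl n) (sgl n)) := by
  unfold PiP
  rw [coeff_gf_mul_gf_eq_card_tr _ _ hn]
  have htr : tr (univ.powerset : Finset (Finset α)) (dbl n) (sgl n) = (sgl n).powerset := by
    ext U; rw [mem_tr, mem_powerset]; simp
  rw [htr]
  -- U ↦ s \ U is a bijection between {U ⊆ s : s \ U ∈ tr 𝒴} and tr 𝒴
  congr 1
  refine card_bij (fun U _ => sgl n \ U) (fun U hU => (mem_filter.1 hU).2) (fun U hU U' hU' h => ?_) (fun U hU => ?_)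
  · have h1 : U ⊆ sgl n := mem_powerset.1 (mem_filter.1 hU).1
    have h2 : U' ⊆ sgl n := mem_powerset.1 (mem_filter.1 hU').1
    rw [← Finset.sdiff_sdiff_eq_self h1, h, Finset.sdiff_sdiff_eq_self h2]
  · have hUs : U ⊆ sgl n := subset_of_mem_tr hU
    refine ⟨sgl n \ U, mem_filter.2 ⟨mem_powerset.2 sdiff_subset, ?_⟩, Finset.sdiff_sdiff_eq_self hUs⟩
    rw [Finset.sdiff_sdiff_eq_self hUs]; exact hU

/-- **The coefficients of the Harris form are Kleitman surpluses of traces**: for `n ≤ 2`,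
`coeff n (Π·GF(𝒳∩𝒵) − GF(𝒳)GF(𝒵)) = kap 𝒳 𝒵 (dbl n) (sgl n)`. [this work] -/
theorem coeff_harrisForm_eq_kap (𝒳 𝒵 : Finset (Finset α)) {n : α →₀ ℕ} (hn : ∀ i, n i ≤ 2) :
    (PiP * gf (𝒳 ∩ 𝒵) - gf 𝒳 * gf 𝒵).coeff n = kap 𝒳 𝒵 (dbl n) (sgl n) := by
  rw [coeff_sub, coeff_PiP_mul_gf_eq_card_tr _ hn, coeff_gf_mul_gf_eq_card_tr _ _ hn, tr_inter]; rfl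

/-- If some exponent is `≥ 3` the Harris form has coefficient `0`. [this work] -/
theorem coeff_harrisForm_eq_zero (𝒳 𝒵 : Finset (Finset α)) {n : α →₀ ℕ} (hn : ¬ ∀ i, n i ≤ 2) :
    (PiP * gf (𝒳 ∩ 𝒵) - gf 𝒳 * gf 𝒵).coeff n = 0 := by
  unfold PiP
  rw [coeff_sub, coeff_gf_mul_gf, coeff_gf_mul_gf, filter_prod_eq_empty _ _ n hn, filter_prod_eq_empty _ _ n hn, card_empty,
    Nat.cast_zero, sub_zero]

/-- For every profile the Harris form of two up-sets has a nonnegative coefficient, equal to `kap` at the cube of the profile when `n ≤ 2`. [this work] -/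
theorem coeff_harrisForm_nonneg_kap {𝒳 𝒵 : Finset (Finset α)} (h𝒳 : IsUpperSet (𝒳 : Set (Finset α)))
    (h𝒵 : IsUpperSet (𝒵 : Set (Finset α))) (n : α →₀ ℕ) : 0 ≤ (PiP * gf (𝒳 ∩ 𝒵) - gf 𝒳 * gf 𝒵).coeff n := by
  by_cases hn : ∀ i, n i ≤ 2
  · rw [coeff_harrisForm_eq_kap _ _ hn]; exact kap_nonneg h𝒳 h𝒵 _ _ (disjoint_dbl_sgl n)
  · rw [coeff_harrisForm_eq_zero _ _ hn]

omit [DecidableEq α] in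
/-- **Peeling `e₂`**: `coeff m (e₂·P) = Σ_{E : #E = 2, 1_E ≤ m} coeff (m − 1_E) P`. [this work] -/
theorem coeff_ee_two_mul (P : MvPolynomial α ℤ) (m : α →₀ ℕ) :
    (ee 2 * P).coeff m = ∑ E ∈ (bySize (· = 2) : Finset (Finset α)).filter (fun E => ind E ≤ m), P.coeff (m - ind E) := by
  unfold ee; exact coeff_gf_mul _ P m



/-- Level set of a profile: `{i : m i = k}`. [this work] -/
def lev (m : α →₀ ℕ) (k : ℕ) : Finset α := m.support.filter fun i => m i = k

omit [DecidableEq α] [Fintype α] in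
/-- Membership in a level set. [this work] -/
theorem mem_lev {m : α →₀ ℕ} {k : ℕ} (hk : k ≠ 0) {i : α} : i ∈ lev m k ↔ m i = k := by
  unfold lev; rw [mem_filter, Finsupp.mem_support_iff]
  exact ⟨fun h => h.2, fun h => ⟨by omega, h⟩⟩

omit [DecidableEq α] [Fintype α] in
/-- `dbl` is the level set `2`. [this work] -/
theorem dbl_eq_lev (m : α →₀ ℕ) : dbl m = lev m 2 := rfl

section Residual
variable {m : α →₀ ℕ} {E : Finset α}

omit [Fintype α] in
/-- The residual profile `m − 1_E` is `≤ 2` iff the tripled points lie in `E` (for `m ≤ 3`, `E ⊆ supp m`). [this work] -/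
theorem sub_ind_le_two_iff (h3 : ∀ i, m i ≤ 3) : (∀ i, (m - ind E) i ≤ 2) ↔ lev m 3 ⊆ E := by
  constructor
  · intro h i hi
    have h1 := h i; rw [SahiAllButC.tsub_ind_apply] at h1
    rw [mem_lev (by norm_num)] at hi
    by_contra hiE; rw [if_neg hiE] at h1; omega
  · intro h i
    rw [SahiAllButC.tsub_ind_apply]
    have := h3 i
    split_ifs with hiE
    · omega
    · by_contra h2
      have : m i = 3 := by omega
      exact hiE (h ((mem_lev (by norm_num)).2 this))

omit [Fintype α] in
/-- Doubled set of the residual profile. [this work] -/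
theorem dbl_sub_ind (h3 : ∀ i, m i ≤ 3) : dbl (m - ind E) = (lev m 3 ∩ E) ∪ (lev m 2 \ E) := by
  ext i
  rw [dbl, mem_filter, Finsupp.mem_support_iff, SahiAllButC.tsub_ind_apply, mem_union, mem_inter, mem_sdiff,
    mem_lev (by norm_num), mem_lev (by norm_num)]
  have := h3 i
  by_cases hiE : i ∈ E
  · rw [if_pos hiE]
    constructor
    · rintro ⟨_, h⟩; exact Or.inl ⟨by omega, hiE⟩
    · rintro (⟨h, _⟩ | ⟨_, h⟩)
      · exact ⟨by omega, by omega⟩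
      · exact absurd hiE h
  · rw [if_neg hiE]
    constructor
    · rintro ⟨_, h⟩; exact Or.inr ⟨by omega, hiE⟩
    · rintro (⟨_, h⟩ | ⟨h, _⟩)
      · exact absurd h hiE
      · exact ⟨by omega, by omega⟩

omit [Fintype α] in
/-- Single set of the residual profile (when the tripled points lie in `E`). [this work] -/
theorem sgl_sub_ind (h3 : ∀ i, m i ≤ 3) (hME : lev m 3 ⊆ E) : sgl (m - ind E) = (lev m 2 ∩ E) ∪ (lev m 1 \ E) := by
  ext i
  rw [sgl, mem_sdiff, dbl, mem_filter, Finsupp.mem_support_iff, SahiAllButC.tsub_ind_apply, mem_union, mem_inter, mem_sdiff,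
    mem_lev (by norm_num), mem_lev (by norm_num)]
  have := h3 i
  have hM3 : i ∉ E → m i ≠ 3 := fun hiE h => hiE (hME ((mem_lev (by norm_num)).2 h))
  by_cases hiE : i ∈ E
  · rw [if_pos hiE]
    constructor
    · rintro ⟨h1, h2⟩
      exact Or.inl ⟨by by_contra h; exact h2 ⟨h1, by omega⟩, hiE⟩
    · rintro (⟨h, _⟩ | ⟨_, h⟩)
      · exact ⟨by omega, fun h' => by omega⟩
      · exact absurd hiE h
  · rw [if_neg hiE]
    have hm3 := hM3 hiE
    constructor
    · rintro ⟨h1, h2⟩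
      exact Or.inr ⟨by by_contra h; exact h2 ⟨h1, by omega⟩, hiE⟩
    · rintro (⟨_, h⟩ | ⟨h, _⟩)
      · exact absurd h hiE
      · exact ⟨by omega, fun h' => by omega⟩

end Residual

/-! ### The charge side `coeff m (Θ₁·e_{≥2}·GF(W))` -/

/-- `γ(n') := coeff n' (Θ₁ · GF(sets of size ≥ 2))` as a count, for `n' ≤ 2`. [this work] -/
theorem coeff_Th1_mul_atLeastTwo_eq {n : α →₀ ℕ} (hn : ∀ i, n i ≤ 2) :
    ((Th1 : MvPolynomial α ℤ) * gf (bySize (2 ≤ ·) : Finset (Finset α))).coeff n =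
      #((sgl n).powerset.filter fun U => #(dbl n) + #U ≤ 1 ∧ 2 ≤ #(dbl n) + #(sgl n \ U)) := by
  unfold Th1
  rw [coeff_gf_mul_gf_eq_card_tr _ _ hn]
  congr 2
  have hdisj : ∀ U ⊆ sgl n, Disjoint (dbl n) U := fun U hU => Disjoint.mono_right hU (disjoint_dbl_sgl n)
  ext U
  simp only [mem_filter, mem_tr, bySize, mem_powerset, subset_univ, true_and]
  constructor
  · rintro ⟨⟨hUs, h1⟩, _, h2⟩
    rw [card_union_of_disjoint (hdisj U hUs)] at h1
    rw [card_union_of_disjoint (hdisj _ sdiff_subset)] at h2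
    exact ⟨hUs, h1, h2⟩
  · rintro ⟨hUs, h1, h2⟩
    refine ⟨⟨hUs, ?_⟩, sdiff_subset, ?_⟩
    · rw [card_union_of_disjoint (hdisj U hUs)]; exact h1
    · rw [card_union_of_disjoint (hdisj _ sdiff_subset)]; exact h2

/-- `γ(n') = 0` when the residual profile has ≥ 2 doubled points. [this work] -/
theorem coeff_Th1_mul_atLeastTwo_eq_zero_of_two_le {n : α →₀ ℕ} (hn : ∀ i, n i ≤ 2) (hd : 2 ≤ #(dbl n)) :
    ((Th1 : MvPolynomial α ℤ) * gf (bySize (2 ≤ ·) : Finset (Finset α))).coeff n = 0 := by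
  rw [coeff_Th1_mul_atLeastTwo_eq hn]
  have : ((sgl n).powerset.filter fun U => #(dbl n) + #U ≤ 1 ∧ 2 ≤ #(dbl n) + #(sgl n \ U)) = ∅ :=
    filter_eq_empty_iff.2 fun U _ h => by omega
  rw [this, card_empty, Nat.cast_zero]

/-- `γ(n') ≤ [1 ≤ t']` when the residual profile has exactly one doubled point (only `U = ∅` can count, and it needs a single point). [this work] -/
theorem coeff_Th1_mul_atLeastTwo_le_one {n : α →₀ ℕ} (hn : ∀ i, n i ≤ 2) (hd : #(dbl n) = 1) :
    ((Th1 : MvPolynomial α ℤ) * gf (bySize (2 ≤ ·) : Finset (Finset α))).coeff n ≤ if 1 ≤ #(sgl n) then 1 else 0 := by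
  rw [coeff_Th1_mul_atLeastTwo_eq hn]
  split_ifs with h1
  · have : ((sgl n).powerset.filter fun U => #(dbl n) + #U ≤ 1 ∧ 2 ≤ #(dbl n) + #(sgl n \ U)) ⊆ {∅} := fun U hU => by
      have h := (mem_filter.1 hU).2.1
      rw [mem_singleton, ← card_eq_zero]; omega
    exact_mod_cast (card_le_card this).trans (card_singleton ∅).le
  · have : ((sgl n).powerset.filter fun U => #(dbl n) + #U ≤ 1 ∧ 2 ≤ #(dbl n) + #(sgl n \ U)) = ∅ :=
      filter_eq_empty_iff.2 fun U _ h => by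
        have : #(sgl n \ U) ≤ #(sgl n) := card_le_card sdiff_subset
        omega
    rw [this, card_empty]; norm_num

/-- `γ(n') ≤ [2 ≤ t'] + t'·[3 ≤ t']` when the residual profile is squarefree (`t'` = number of single points). [this work] -/
theorem coeff_Th1_mul_atLeastTwo_le_sqfree {n : α →₀ ℕ} (hn : ∀ i, n i ≤ 2) (hd : #(dbl n) = 0) :
    ((Th1 : MvPolynomial α ℤ) * gf (bySize (2 ≤ ·) : Finset (Finset α))).coeff n ≤
      (if 2 ≤ #(sgl n) then 1 else 0) + (if 3 ≤ #(sgl n) then (#(sgl n) : ℤ) else 0) := by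
  rw [coeff_Th1_mul_atLeastTwo_eq hn]
  set s := sgl n
  -- the counted sets have size ≤ 1: split into ∅ and singletons
  have hsub : (s.powerset.filter fun U => #(dbl n) + #U ≤ 1 ∧ 2 ≤ #(dbl n) + #(s \ U)) ⊆
      (s.powersetCard 0).filter (fun _ => 2 ≤ #s) ∪ (s.powersetCard 1).filter (fun _ => 3 ≤ #s) := fun U hU => by
    obtain ⟨hUs, h1, h2⟩ := mem_filter.1 hU
    rw [mem_powerset] at hUs
    rw [hd, zero_add] at h1 h2
    rw [card_sdiff_of_subset hUs] at h2
    rw [mem_union, mem_filter, mem_filter, mem_powersetCard, mem_powersetCard]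
    rcases Nat.lt_or_ge (#U) 1 with h | h
    · left; exact ⟨⟨hUs, by omega⟩, by omega⟩
    · right; exact ⟨⟨hUs, by omega⟩, by omega⟩
  have hA : (#((s.powersetCard 0).filter fun _ => 2 ≤ #s) : ℤ) = if 2 ≤ #s then 1 else 0 := by
    split_ifs with h
    · rw [filter_true_of_mem fun _ _ => h, card_powersetCard, Nat.choose_zero_right]; norm_num
    · rw [filter_false_of_mem fun _ _ => h, card_empty]; norm_num
  have hB : (#((s.powersetCard 1).filter fun _ => 3 ≤ #s) : ℤ) = if 3 ≤ #s then (#s : ℤ) else 0 := by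
    split_ifs with h
    · rw [filter_true_of_mem fun _ _ => h, card_powersetCard, Nat.choose_one_right]
    · rw [filter_false_of_mem fun _ _ => h, card_empty]; norm_num
  have h1 : (#(s.powerset.filter fun U => #(dbl n) + #U ≤ 1 ∧ 2 ≤ #(dbl n) + #(s \ U)) : ℤ) ≤
      #((s.powersetCard 0).filter (fun _ => 2 ≤ #s) ∪ (s.powersetCard 1).filter (fun _ => 3 ≤ #s)) := by
    exact_mod_cast card_le_card hsub
  have h2 : (#((s.powersetCard 0).filter (fun _ => 2 ≤ #s) ∪ (s.powersetCard 1).filter (fun _ => 3 ≤ #s)) : ℤ) ≤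
      #((s.powersetCard 0).filter fun _ => 2 ≤ #s) + #((s.powersetCard 1).filter fun _ => 3 ≤ #s) := by
    exact_mod_cast card_union_le _ _
  rw [← hA, ← hB]; linarith

/-- `γ(n') = 0` when the residual profile has an exponent ≥ 3. [this work] -/
theorem coeff_Th1_mul_atLeastTwo_eq_zero {n : α →₀ ℕ} (hn : ¬ ∀ i, n i ≤ 2) :
    ((Th1 : MvPolynomial α ℤ) * gf (bySize (2 ≤ ·) : Finset (Finset α))).coeff n = 0 := by
  unfold Th1; rw [coeff_gf_mul_gf, filter_prod_eq_empty _ _ n hn, card_empty, Nat.cast_zero]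

/-- `γ ≥ 0`. [this work] -/
theorem coeff_Th1_mul_atLeastTwo_nonneg (n : α →₀ ℕ) :
    0 ≤ ((Th1 : MvPolynomial α ℤ) * gf (bySize (2 ≤ ·) : Finset (Finset α))).coeff n := by
  unfold Th1; exact coeff_mul_nonneg (coeff_gf_nonneg _) (coeff_gf_nonneg _) n

omit [DecidableEq α] in
/-- **The charge side**: `coeff m (Θ₁·e_{≥2}·GF(W)) = Σ_{e ∈ W, 1_e ≤ m} γ(m − 1_e)`. [this work] -/
theorem coeff_charge_eq_sum (W : Finset (Finset α)) (m : α →₀ ℕ) :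
    ((Th1 : MvPolynomial α ℤ) * gf (bySize (2 ≤ ·) : Finset (Finset α)) * gf W).coeff m =
      ∑ e ∈ W.filter (fun e => ind e ≤ m), ((Th1 : MvPolynomial α ℤ) * gf (bySize (2 ≤ ·) : Finset (Finset α))).coeff (m - ind e) := by
  rw [mul_comm, coeff_gf_mul]

/-! ### The surplus side `coeff m (e₂·H)` -/

/-- **The surplus side** dominates any partial sum of residual Harris coefficients (all of which are ≥ 0):
for `S ⊆ {E : #E = 2, 1_E ≤ m}`, `Σ_{E ∈ S} coeff (m − 1_E) H ≤ coeff m (e₂·H)`. [this work] -/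
theorem sum_le_coeff_ee_two_mul_harris {𝒳 𝒵 : Finset (Finset α)} (h𝒳 : IsUpperSet (𝒳 : Set (Finset α)))
    (h𝒵 : IsUpperSet (𝒵 : Set (Finset α))) (m : α →₀ ℕ) {S : Finset (Finset α)}
    (hS : S ⊆ (bySize (· = 2) : Finset (Finset α)).filter fun E => ind E ≤ m) :
    ∑ E ∈ S, (PiP * gf (𝒳 ∩ 𝒵) - gf 𝒳 * gf 𝒵).coeff (m - ind E) ≤
      (ee 2 * (PiP * gf (𝒳 ∩ 𝒵) - gf 𝒳 * gf 𝒵)).coeff m := by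
  rw [coeff_ee_two_mul]
  exact sum_le_sum_of_subset_of_nonneg hS fun E _ _ => coeff_harrisForm_nonneg_kap h𝒳 h𝒵 _

/-- A 2-subset of the support is an admissible `E`. [this work] -/
theorem pair_mem_admissible {m : α →₀ ℕ} {a b : α} (hab : a ≠ b) (ha : a ∈ m.support) (hb : b ∈ m.support) :
    ({a, b} : Finset α) ∈ (bySize (· = 2) : Finset (Finset α)).filter fun E => ind E ≤ m := by
  refine mem_filter.2 ⟨?_, (SahiAllButC.ind_le_iff_subset_support _ _).2 (insert_subset ha (singleton_subset_iff.2 hb))⟩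
  unfold bySize; exact mem_filter.2 ⟨mem_powerset.2 (subset_univ _), card_pair hab⟩

end Summit.CriticalPhenomena.PercolationContinuityZ3.Theorems.SahiCTCForms
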